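import Mathlib
import Literature.Barriers.MatrixMultiplication.NormalizerBarrier
import Literature.RepresentationTheory.FiniteGroups.IrreducibleCharacters
import Literature.RepresentationTheory.FiniteGroups.InducedClassFunction
import Summits.MatrixMultiplication.MatrixMultiplication.Theorems.LieRankDesigns.Negative.Basics
import Summits.MatrixMultiplication.MatrixMultiplication.Theorems.SubgroupIdentityDesigns.Negative.BlockSliceTranslate
import Summits.MatrixMultiplication.MatrixMultiplication.Theorems.SubgroupIdentityDesigns.Negative.GrassmannNoGo
import Summits.MatrixMultiplication.MatrixMultiplication.Theorems.SubgroupIdentityDesigns.Negative.PrincipalSeriesBudget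
import Summits.MatrixMultiplication.MatrixMultiplication.Theorems.SubgroupIdentityDesigns.Negative.FlagCharacter
import Summits.MatrixMultiplication.MatrixMultiplication.Theorems.SubgroupIdentityDesigns.Negative.FlagDegree
import Summits.MatrixMultiplication.MatrixMultiplication.Theorems.SubgroupIdentityDesigns.Negative.FlagTwist
import Summits.MatrixMultiplication.MatrixMultiplication.Theorems.SubgroupIdentityDesigns.Negative.FlagTwistNorm
import Summits.MatrixMultiplication.MatrixMultiplication.Theorems.SubgroupIdentityDesigns.Negative.FlagTwistNoGo
import Summits.MatrixMultiplication.MatrixMultiplication.Theorems.SubgroupIdentityDesigns.Negative.FlagTwistOrtho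

/-!
# `C(p−2, k)` distinct principal-series characters of level `≤ k`; block slices with `l ∈ {1, 2}`

Supports stmt-MatrixMultiplication-14079 (crux `SubgroupIdentityDesigns`, route `LevelGradedCohnUmans`;
BLOCK-SLICES §2).  VALUE = theorems (a `C(p−2,k)`-fold lower bound for the crux's level-`k` budget
and the resulting no-go for block-slice triples with THIN complementary block, `l = m − k ∈ {1, 2}`,
at every sufficiently large prime), NOT summit progress: the crux stays open.

* `tup`, `twChar_ne_of_ne` — for every `k`-set `S` of non-trivial multiplicative characters of `𝔽_p`
  the twisted flag character `Ψ_S = Ind_{P'}^G (χ_1 ⊗ ⋯ ⊗ χ_k ⊗ 1)` (`FlagTwist`) is an irreducible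
  character of `GL_{k+l}(𝔽_p)` of level `≤ k` and degree `[G : P'] ≥ p^{kl + k(k-1)/2}`
  (`FlagTwistNorm`, `FlagDegree`), and `S ≠ S' ⇒ Ψ_S ≠ Ψ_{S'}` (`FlagTwistOrtho.twChar_ne`);
* **`budget_ge_family`** — hence `budget(p, k+l, k, s) ≥ C(p−2, k) · (p^{kl} p^{∑_{i<k} i})^s`;
* `not_budget_lt_of_le(_translate)` — any budget lower bound `B ≥ (p^{3k²+5kl})^{s/6}` excludes
  block-slice TPP triples (their volume has `V² < p^{3k²+5kl}`, `GrassmannNoGo.volume_sq_lt_real`);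
* `threshold_of_choose` — the family bound beats that threshold as soon as
  `p^{k(3−l)s/6} ≤ C(p−2, k)`; so (`no_translate_witness`) NO block-slice triple of `GL_{k+l}(𝔽_p)`
  (product set inside a two-sided translate of `{g : g_{[k,k+l)×[k,k+l)} = 1}`) witnesses the crux at
  `ε` when `p^{k(3−l)(2+ε)/6} ≤ C(p−2,k)`: for `l ≥ 3` this is `p ≥ k + 2` (`FlagTwistNoGo`), for
  **`l = 2`** it holds whenever `2k · p^{(2+ε)/6} ≤ p` (`no_translate_witness_two`; every `ε < 4`,
  `p ≥ (2k)^{6/(4−ε)}`), for **`l = 1`** whenever `2k · p^{(2+ε)/3} ≤ p` (`no_translate_witness_one`;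
  `ε < 1`, `p ≥ (2k)^{3/(1−ε)}`), via `rpow_le_choose : p^{tk} ≤ C(p−2,k)`.
What stays open for block slices: `l ∈ {1, 2}` at small primes, and `l = 1` for `ε ≥ 1` (there the
principal series alone is too small; cuspidal / Deligne–Lusztig characters would be needed).
-/

set_option linter.dupNamespace false

noncomputable section

open scoped BigOperators Matrix Classical
open Literature.Barriers.MatrixMultiplication (SubgroupTPP)
open Literature.RepresentationTheory.FiniteGroups
open Summit.MatrixMultiplication.MatrixMultiplication.Theorems.LieRankDesigns.Negative

namespace Summit.MatrixMultiplication.MatrixMultiplication.Theorems.SubgroupIdentityDesigns.Negative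
namespace FlagTwistFamily

open FlagCharacter (flagStab)
open FlagDegree (two_mul_sum_range)
open FlagTwist (twChar twChar_mem_levelSet)
open FlagTwistNorm (isIrrChar_twChar)
open FlagTwistNoGo (twChar_one_ge)
open FlagTwistOrtho (twChar_ne)
open PrincipalSeriesBudget (card_mulChar)
open GrassmannNoGo (volume_sq_lt_real)
open BlockSliceTranslate (translate_to_conj_fin)

variable {p : ℕ} [hp : Fact p.Prime] {k l : ℕ}

/-! ## Tuples enumerating a `k`-set of characters -/

/-- An enumeration `Fin k → S` of a `k`-set `S` of multiplicative characters. -/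
def tup (S : Finset (MulChar (ZMod p) ℂ)) (hS : S.card = k) : Fin k → MulChar (ZMod p) ℂ :=
  fun i => (((Finset.equivFinOfCardEq hS).symm i : S) : MulChar (ZMod p) ℂ)

omit hp in
/-- `tup S i ∈ S`. -/
theorem tup_mem (S : Finset (MulChar (ZMod p) ℂ)) (hS : S.card = k) (i : Fin k) : tup S hS i ∈ S :=
  ((Finset.equivFinOfCardEq hS).symm i).2

omit hp in
/-- `tup S` is injective. -/
theorem tup_injective (S : Finset (MulChar (ZMod p) ℂ)) (hS : S.card = k) :
    Function.Injective (tup S hS) :=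
  Subtype.val_injective.comp (Finset.equivFinOfCardEq hS).symm.injective

omit hp in
/-- `tup S` hits every element of `S`. -/
theorem exists_tup_eq {S : Finset (MulChar (ZMod p) ℂ)} (hS : S.card = k)
    {χ : MulChar (ZMod p) ℂ} (hχ : χ ∈ S) : ∃ i, tup S hS i = χ :=
  ⟨Finset.equivFinOfCardEq hS ⟨χ, hχ⟩, by simp [tup]⟩

omit hp in
/-- If `1 ∉ S` then every `tup S i ≠ 1`. -/
theorem tup_ne_one {S : Finset (MulChar (ZMod p) ℂ)} (hS : S.card = k)
    (h1 : (1 : MulChar (ZMod p) ℂ) ∉ S) (i : Fin k) : tup S hS i ≠ 1 :=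
  fun e => h1 (e ▸ tup_mem S hS i)

omit hp in
/-- Distinct `k`-sets give tuples that are not rearrangements of each other. -/
theorem tup_ne_comp {S S' : Finset (MulChar (ZMod p) ℂ)} (hS : S.card = k) (hS' : S'.card = k)
    (hne : S ≠ S') (σ : Equiv.Perm (Fin k)) : tup S' hS' ≠ tup S hS ∘ σ := by
  intro e
  refine hne (Finset.eq_of_subset_of_card_le (fun χ hχ => ?_) (by rw [hS, hS'])).symm
  obtain ⟨i, hi⟩ := exists_tup_eq hS' hχ
  rw [← hi, show tup S' hS' i = tup S hS (σ i) from congr_fun e i]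
  exact tup_mem S hS (σ i)

/-- **Distinct `k`-sets of non-trivial characters give distinct `Ψ`** (`FlagTwistOrtho.twChar_ne`). -/
theorem twChar_ne_of_ne {S S' : Finset (MulChar (ZMod p) ℂ)} (hS : S.card = k) (hS' : S'.card = k)
    (h1 : (1 : MulChar (ZMod p) ℂ) ∉ S) (h1' : (1 : MulChar (ZMod p) ℂ) ∉ S') (hne : S ≠ S') :
    twChar (l := l) (tup S hS) ≠ twChar (tup S' hS') :=
  twChar_ne (tup_injective S hS) (tup_ne_one hS h1) (tup_ne_one hS' h1') (tup_ne_comp hS hS' hne)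

/-- The family member attached to a finset `S` (zero unless `|S| = k`). -/
def psi (k l : ℕ) (S : Finset (MulChar (ZMod p) ℂ)) : GLm p (k + l) → ℂ :=
  if hS : S.card = k then twChar (l := l) (tup S hS) else 0

/-! ## The budget lower bound -/

/-- **`budget(p, k+l, k, s) ≥ C(p−2, k) · (p^{kl} · p^{∑_{i<k} i})^s`** for `s ≥ 0`: the `C(p−2,k)`
characters `Ψ_S`, `S` a `k`-set of non-trivial characters of `𝔽_p^×`, are distinct irreducible
characters of level `≤ k` and degree `≥ p^{kl} p^{k(k−1)/2}`. -/
theorem budget_ge_family {s : ℝ} (hs : 0 ≤ s) :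
    ((Nat.choose (p - 2) k : ℕ) : ℝ) * (((p ^ (k * l) * p ^ (∑ i ∈ Finset.range k, i) : ℕ) : ℝ)) ^ s
      ≤ budget p (k + l) k s := by
  letI : Fintype (MulChar (ZMod p) ℂ) := Fintype.ofFinite _
  have hfin : (irrChars (GLm p (k + l)) ∩ levelSet p (k + l) k).Finite :=
    (irrChars_finite_holds (GLm p (k + l))).subset Set.inter_subset_left
  set T : Finset (Finset (MulChar (ZMod p) ℂ)) :=
    (Finset.univ.erase (1 : MulChar (ZMod p) ℂ)).powersetCard k with hT
  have hmemT : ∀ S ∈ T, S.card = k ∧ (1 : MulChar (ZMod p) ℂ) ∉ S := by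
    intro S hS
    rw [Finset.mem_powersetCard] at hS
    exact ⟨hS.2, fun h1 => by simpa using hS.1 h1⟩
  have hinj : Set.InjOn (psi (p := p) k l) ↑T := by
    intro S hS S' hS' e
    by_contra hne
    obtain ⟨hSk, hS1⟩ := hmemT S hS
    obtain ⟨hS'k, hS'1⟩ := hmemT S' hS'
    simp only [psi, dif_pos hSk, dif_pos hS'k] at e
    exact twChar_ne_of_ne hSk hS'k hS1 hS'1 hne e
  have hsub : T.image (psi (p := p) k l) ⊆ hfin.toFinset := by
    intro ψ hψ
    rw [Set.Finite.mem_toFinset]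
    obtain ⟨S, hS, rfl⟩ := Finset.mem_image.mp hψ
    obtain ⟨hSk, hS1⟩ := hmemT S hS
    simp only [psi, dif_pos hSk]
    exact ⟨isIrrChar_twChar (tup_injective S hSk) (tup_ne_one hSk hS1), twChar_mem_levelSet _⟩
  have hdeg : ∀ S ∈ T, (((p ^ (k * l) * p ^ (∑ i ∈ Finset.range k, i) : ℕ) : ℝ)) ^ s ≤
      ((psi (p := p) k l S) 1).re ^ s := by
    intro S hS
    obtain ⟨hSk, -⟩ := hmemT S hS
    simp only [psi, dif_pos hSk]
    exact Real.rpow_le_rpow (Nat.cast_nonneg _) (twChar_one_ge _) hs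
  have hcount : T.card = Nat.choose (p - 2) k := by
    rw [hT, Finset.card_powersetCard, Finset.card_erase_of_mem (Finset.mem_univ _), Finset.card_univ,
      ← Nat.card_eq_fintype_card, card_mulChar]
    congr 1
  calc ((Nat.choose (p - 2) k : ℕ) : ℝ) *
        (((p ^ (k * l) * p ^ (∑ i ∈ Finset.range k, i) : ℕ) : ℝ)) ^ s
      = ∑ S ∈ T, (((p ^ (k * l) * p ^ (∑ i ∈ Finset.range k, i) : ℕ) : ℝ)) ^ s := by
        rw [Finset.sum_const, hcount, nsmul_eq_mul]
    _ ≤ ∑ S ∈ T, ((psi (p := p) k l S) 1).re ^ s := Finset.sum_le_sum hdeg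
    _ = ∑ ψ ∈ T.image (psi (p := p) k l), (ψ 1).re ^ s := by rw [Finset.sum_image hinj]
    _ ≤ ∑ ψ ∈ hfin.toFinset, (ψ 1).re ^ s :=
        Finset.sum_le_sum_of_subset_of_nonneg hsub fun ψ hψ _ =>
          Real.rpow_nonneg (re_apply_one_nonneg (hfin.mem_toFinset.mp hψ).1) s
    _ = budget p (k + l) k s := by
        unfold budget
        rw [finsum_mem_eq_finite_toFinset_sum _ hfin]

/-! ## Budget lower bounds versus block-slice volumes -/

/-- **A budget lower bound `B ≥ (p^{3k²+5kl})^{s/6}` excludes block-slice triples** (conjugate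
form): their volume satisfies `V² < p^{3k²+5kl}` (`GrassmannNoGo.volume_sq_lt_real`), so
`V^{s/3} = (V²)^{s/6} < B ≤ budget`. -/
theorem not_budget_lt_of_le (hk : 1 ≤ k) {s : ℝ} (hs : 0 < s) {B : ℝ} (hB : B ≤ budget p (k + l) k s)
    (hthr : ((p : ℝ) ^ (3 * (k * k) + 5 * k * l)) ^ (s / 6) ≤ B)
    {H₁ H₂ H₃ : Subgroup (GLm p (k + l))} (htpp : SubgroupTPP H₁ H₂ H₃) (x : GLm p (k + l))
    (hS : ∀ a ∈ H₁, ∀ b ∈ H₂, ∀ c ∈ H₃, ∀ i j : Fin l,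
      ((x⁻¹ * (a * b * c) * x : GLm p (k + l)) : Mat p (k + l)) (Fin.natAdd k i) (Fin.natAdd k j) =
        (1 : Matrix (Fin l) (Fin l) (ZMod p)) i j) :
    ¬ (budget p (k + l) k s < ((Nat.card H₁ * Nat.card H₂ * Nat.card H₃ : ℕ) : ℝ) ^ (s / 3)) := by
  intro hlt
  have hV := volume_sq_lt_real hk htpp x hS
  set V : ℝ := ((Nat.card H₁ * Nat.card H₂ * Nat.card H₃ : ℕ) : ℝ) with hVdef
  have hV0 : 0 ≤ V := Nat.cast_nonneg _
  have h1 : V ^ (s / 3) = (V ^ 2) ^ (s / 6) := by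
    rw [← Real.rpow_two, ← Real.rpow_mul hV0]
    congr 1
    ring
  have h2 : (V ^ 2) ^ (s / 6) < ((p : ℝ) ^ (3 * (k * k) + 5 * k * l)) ^ (s / 6) :=
    Real.rpow_lt_rpow (by positivity) hV (by linarith)
  rw [h1] at hlt
  linarith

/-- **The same on every two-sided translate `x S y`.** -/
theorem not_budget_lt_of_le_translate (hk : 1 ≤ k) {s : ℝ} (hs : 0 < s) {B : ℝ}
    (hB : B ≤ budget p (k + l) k s) (hthr : ((p : ℝ) ^ (3 * (k * k) + 5 * k * l)) ^ (s / 6) ≤ B)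
    {H₁ H₂ H₃ : Subgroup (GLm p (k + l))} (htpp : SubgroupTPP H₁ H₂ H₃) (x y : GLm p (k + l))
    (hS : ∀ a ∈ H₁, ∀ b ∈ H₂, ∀ c ∈ H₃, ∀ i j : Fin l,
      ((x⁻¹ * (a * b * c) * y⁻¹ : GLm p (k + l)) : Mat p (k + l)) (Fin.natAdd k i)
          (Fin.natAdd k j) = (1 : Matrix (Fin l) (Fin l) (ZMod p)) i j) :
    ¬ (budget p (k + l) k s < ((Nat.card H₁ * Nat.card H₂ * Nat.card H₃ : ℕ) : ℝ) ^ (s / 3)) := by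
  have h1 := hS 1 H₁.one_mem 1 H₂.one_mem 1 H₃.one_mem
  simp only [mul_one] at h1
  obtain ⟨z, hz⟩ := translate_to_conj_fin x y h1
  exact not_budget_lt_of_le hk hs hB hthr htpp z (fun a ha b hb c hc => hz _ (hS a ha b hb c hc))

/-! ## The family bound beats the threshold when `p^{k(3−l)s/6} ≤ C(p−2,k)` -/

/-- `3k² + 5kl = k(3 − l) + 6 (kl + ∑_{i<k} i)` (as reals). -/
theorem exp_split_real :
    ((3 * (k * k) + 5 * k * l : ℕ) : ℝ) =
      (k : ℝ) * (3 - (l : ℝ)) + 6 * ((k * l + ∑ i ∈ Finset.range k, i : ℕ) : ℝ) := by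
  have h2 := two_mul_sum_range k
  obtain ⟨S, hS⟩ : ∃ S, ∑ i ∈ Finset.range k, i = S := ⟨_, rfl⟩
  rw [hS] at h2 ⊢
  rcases Nat.eq_zero_or_pos k with rfl | hk
  · simp at h2
    subst h2
    simp
  · have h2' : (2 : ℝ) * (S : ℝ) = (k : ℝ) * ((k : ℝ) - 1) := by
      have h := congrArg (Nat.cast (R := ℝ)) h2
      push_cast [Nat.cast_pred hk] at h
      exact h
    push_cast
    linear_combination (-3 : ℝ) * h2'

/-- **Threshold**: if `p^{k(3−l)s/6} ≤ C(p−2,k)` (`s ≥ 0`) then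
`(p^{3k²+5kl})^{s/6} ≤ C(p−2,k) · (p^{kl} p^{∑_{i<k} i})^s`. -/
theorem threshold_of_choose {s : ℝ}
    (h : (p : ℝ) ^ ((k : ℝ) * (3 - (l : ℝ)) * s / 6) ≤ ((Nat.choose (p - 2) k : ℕ) : ℝ)) :
    ((p : ℝ) ^ (3 * (k * k) + 5 * k * l)) ^ (s / 6) ≤
      ((Nat.choose (p - 2) k : ℕ) : ℝ) *
        (((p ^ (k * l) * p ^ (∑ i ∈ Finset.range k, i) : ℕ) : ℝ)) ^ s := by
  have hp0 : (0 : ℝ) < p := Nat.cast_pos.mpr hp.out.pos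
  have e1 : ((p : ℝ) ^ (3 * (k * k) + 5 * k * l)) ^ (s / 6) =
      (p : ℝ) ^ (((3 * (k * k) + 5 * k * l : ℕ) : ℝ) * (s / 6)) := by
    rw [Real.rpow_mul hp0.le, Real.rpow_natCast]
  have e2 : (((p ^ (k * l) * p ^ (∑ i ∈ Finset.range k, i) : ℕ) : ℝ)) ^ s =
      (p : ℝ) ^ (((k * l + ∑ i ∈ Finset.range k, i : ℕ) : ℝ) * s) := by
    rw [Real.rpow_mul hp0.le, Real.rpow_natCast, pow_add]
    push_cast
    ring
  rw [e1, e2, exp_split_real]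
  have e3 : ((k : ℝ) * (3 - (l : ℝ)) + 6 * ((k * l + ∑ i ∈ Finset.range k, i : ℕ) : ℝ)) * (s / 6) =
      (k : ℝ) * (3 - (l : ℝ)) * s / 6 + ((k * l + ∑ i ∈ Finset.range k, i : ℕ) : ℝ) * s := by ring
  rw [e3, Real.rpow_add hp0]
  exact mul_le_mul_of_nonneg_right h (Real.rpow_nonneg hp0.le _)

/-- **No block-slice witness once `p^{k(3−l)(2+ε)/6} ≤ C(p−2, k)`** (`k ≥ 1`, any `l`, two-sided
translates included).  For `l ≥ 3` the condition is `k + 2 ≤ p`; for `l = 2` resp. `l = 1` see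
`no_translate_witness_two` / `no_translate_witness_one`. -/
theorem no_translate_witness (hk : 1 ≤ k) {ε : ℝ} (hε : 0 < ε)
    (h : (p : ℝ) ^ ((k : ℝ) * (3 - (l : ℝ)) * (2 + ε) / 6) ≤ ((Nat.choose (p - 2) k : ℕ) : ℝ))
    {H₁ H₂ H₃ : Subgroup (GLm p (k + l))} (htpp : SubgroupTPP H₁ H₂ H₃) (x y : GLm p (k + l))
    (hS : ∀ a ∈ H₁, ∀ b ∈ H₂, ∀ c ∈ H₃, ∀ i j : Fin l,
      ((x⁻¹ * (a * b * c) * y⁻¹ : GLm p (k + l)) : Mat p (k + l)) (Fin.natAdd k i)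
          (Fin.natAdd k j) = (1 : Matrix (Fin l) (Fin l) (ZMod p)) i j) :
    ¬ ((∑ᶠ ψ ∈ irrChars (GLm p (k + l)) ∩ levelSet p (k + l) k, (ψ 1).re ^ (2 + ε)) <
        ((Nat.card H₁ * Nat.card H₂ * Nat.card H₃ : ℕ) : ℝ) ^ ((2 + ε) / 3)) :=
  not_budget_lt_of_le_translate hk (by linarith) (budget_ge_family (by linarith))
    (threshold_of_choose h) htpp x y hS

/-! ## Explicit sufficient conditions -/

/-- **`p^{tk} ≤ C(p−2, k)`** when `p ≥ 2k + 2` and `2k · p^t ≤ p`: indeed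
`C(p−2,k) ≥ (p−1−k)^k / k! ≥ ((p−1−k)/k)^k ≥ (p/(2k))^k ≥ (p^t)^k`. -/
theorem rpow_le_choose (hk : 1 ≤ k) (hp2 : 2 * k + 2 ≤ p) {t : ℝ}
    (ht : (2 * k : ℝ) * (p : ℝ) ^ t ≤ p) :
    (p : ℝ) ^ (t * k) ≤ ((Nat.choose (p - 2) k : ℕ) : ℝ) := by
  have hp0 : (0 : ℝ) < p := Nat.cast_pos.mpr hp.out.pos
  have hk0 : (0 : ℝ) < k := Nat.cast_pos.mpr hk
  have h1 : (p : ℝ) ^ t ≤ ((p - 1 - k : ℕ) : ℝ) / k := by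
    rw [le_div_iff₀ hk0, Nat.cast_sub (by omega), Nat.cast_sub (by omega)]
    push_cast
    have h2k : (2 * k + 2 : ℝ) ≤ p := by exact_mod_cast hp2
    nlinarith [ht, Real.rpow_nonneg hp0.le t]
  have h2 : (((p - 1 - k : ℕ) : ℝ) / k) ^ k ≤ ((Nat.choose (p - 2) k : ℕ) : ℝ) := by
    have h3 := Nat.pow_le_choose (α := ℝ) k (p - 2)
    have e : p - 2 + 1 - k = p - 1 - k := by omega
    rw [e] at h3
    have hfac : ((Nat.factorial k : ℕ) : ℝ) ≤ (k : ℝ) ^ k := by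
      exact_mod_cast Nat.factorial_le_pow k
    have hfac0 : (0 : ℝ) < ((Nat.factorial k : ℕ) : ℝ) := by exact_mod_cast Nat.factorial_pos k
    calc (((p - 1 - k : ℕ) : ℝ) / k) ^ k = ((p - 1 - k : ℕ) : ℝ) ^ k / (k : ℝ) ^ k := div_pow _ _ _
      _ ≤ ((p - 1 - k : ℕ) : ℝ) ^ k / ((Nat.factorial k : ℕ) : ℝ) :=
          div_le_div_of_nonneg_left (by positivity) hfac0 hfac
      _ ≤ _ := by exact_mod_cast h3
  calc (p : ℝ) ^ (t * k) = ((p : ℝ) ^ t) ^ k := Real.rpow_mul_natCast hp0.le t k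
    _ ≤ (((p - 1 - k : ℕ) : ℝ) / k) ^ k := pow_le_pow_left₀ (Real.rpow_nonneg hp0.le t) h1 k
    _ ≤ _ := h2

/-- **`l = 2`: no block-slice witness in `GL_{k+2}(𝔽_p)` whenever `2k · p^{(2+ε)/6} ≤ p`**
(`p ≥ 2k + 2`; e.g. every `ε < 4` and `p ≥ (2k)^{6/(4−ε)}`). -/
theorem no_translate_witness_two (hk : 1 ≤ k) (hp2 : 2 * k + 2 ≤ p) {ε : ℝ} (hε : 0 < ε)
    (ht : (2 * k : ℝ) * (p : ℝ) ^ ((2 + ε) / 6) ≤ p)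
    {H₁ H₂ H₃ : Subgroup (GLm p (k + 2))} (htpp : SubgroupTPP H₁ H₂ H₃) (x y : GLm p (k + 2))
    (hS : ∀ a ∈ H₁, ∀ b ∈ H₂, ∀ c ∈ H₃, ∀ i j : Fin 2,
      ((x⁻¹ * (a * b * c) * y⁻¹ : GLm p (k + 2)) : Mat p (k + 2)) (Fin.natAdd k i)
          (Fin.natAdd k j) = (1 : Matrix (Fin 2) (Fin 2) (ZMod p)) i j) :
    ¬ ((∑ᶠ ψ ∈ irrChars (GLm p (k + 2)) ∩ levelSet p (k + 2) k, (ψ 1).re ^ (2 + ε)) <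
        ((Nat.card H₁ * Nat.card H₂ * Nat.card H₃ : ℕ) : ℝ) ^ ((2 + ε) / 3)) := by
  refine no_translate_witness hk hε ?_ htpp x y hS
  have e : (k : ℝ) * (3 - ((2 : ℕ) : ℝ)) * (2 + ε) / 6 = (2 + ε) / 6 * k := by push_cast; ring
  rw [e]
  exact rpow_le_choose hk hp2 ht

/-- **`l = 1`: no block-slice witness in `GL_{k+1}(𝔽_p)` whenever `2k · p^{(2+ε)/3} ≤ p`**
(`p ≥ 2k + 2`; e.g. every `ε < 1` and `p ≥ (2k)^{3/(1−ε)}`). -/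
theorem no_translate_witness_one (hk : 1 ≤ k) (hp2 : 2 * k + 2 ≤ p) {ε : ℝ} (hε : 0 < ε)
    (ht : (2 * k : ℝ) * (p : ℝ) ^ ((2 + ε) / 3) ≤ p)
    {H₁ H₂ H₃ : Subgroup (GLm p (k + 1))} (htpp : SubgroupTPP H₁ H₂ H₃) (x y : GLm p (k + 1))
    (hS : ∀ a ∈ H₁, ∀ b ∈ H₂, ∀ c ∈ H₃, ∀ i j : Fin 1,
      ((x⁻¹ * (a * b * c) * y⁻¹ : GLm p (k + 1)) : Mat p (k + 1)) (Fin.natAdd k i)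
          (Fin.natAdd k j) = (1 : Matrix (Fin 1) (Fin 1) (ZMod p)) i j) :
    ¬ ((∑ᶠ ψ ∈ irrChars (GLm p (k + 1)) ∩ levelSet p (k + 1) k, (ψ 1).re ^ (2 + ε)) <
        ((Nat.card H₁ * Nat.card H₂ * Nat.card H₃ : ℕ) : ℝ) ^ ((2 + ε) / 3)) := by
  refine no_translate_witness hk hε ?_ htpp x y hS
  have e : (k : ℝ) * (3 - ((1 : ℕ) : ℝ)) * (2 + ε) / 6 = (2 + ε) / 3 * k := by push_cast; ring
  rw [e]
  exact rpow_le_choose hk hp2 ht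

end FlagTwistFamily
end Summit.MatrixMultiplication.MatrixMultiplication.Theorems.SubgroupIdentityDesigns.Negative

end
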